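import Summits.QuantumAdvantage.QuantumAdvantage.Theorems.CharDialTransferDialD
import HarnessLib

/-!
# TransferDial E — ASSEMBLY: `transferOfFieldCore_holds : TransferOfFieldCore` and ★ `closes_of_PF`

Re-index the block map onto its used blocks (`reindex`), enumerate the free patterns, and turn the period functionals of the
residue vector (part B `field_core`) into linear forms on the cube: `transferOfFieldCore_holds`.  Hence
`closes_of_PF : FieldCorePerPrime → PartnersTwoOdd → StructureLawTwoOdd` — piece B from the field core PF (lens-6 g22, on paper
from Bhowmick–Lovett style equidistribution [arXiv:1212.3849] + Assmus–Key 5.7.9) and the one open leaf `PartnersTwoOdd`, with the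
implication checked by the kernel end to end.

Tree twin, part E of 5, of the decomp-qadv lens-6 g23 node «TransferDial» (`Theses/TransferDial.lean` rev 3, sha256
1b7fda5a…95ba; declaration bodies copied verbatim, namespace `…Theses.TransferDial` ↦ `…Theorems.TransferDial`).
Residual mode beneath `Theses.CharDial.FrobLiftOdd` (stmt 32599): the target `StructureLawTwoOdd` = lens-6 g20 piece B.
0 sorry; no `instance`, no `notation`, no `native_decide`.
-/

set_option autoImplicit false
set_option linter.dupNamespace false

namespace Summit.QuantumAdvantage.QuantumAdvantage.Theorems.TransferDial

open Classical
open Finset Module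
open Summit.QuantumAdvantage.AdviceFreeQNC0
open Literature.Computability.MetaComplexity Literature.Computability.MetaComplexity.Smolensky

/-! ## §6 Kernel: ASSEMBLY — `TransferOfFieldCore` (NODE §2 (T7): re-index onto the used blocks, enumerate the free patterns,
turn period functionals of the residue vector into linear forms on the cube) -/

section Assembly
variable {p : ℕ} [hp : Fact p.Prime]
open SubChar

/-- Re-index a block map onto its USED blocks. -/
theorem reindex {m r : ℕ} (b : Fin m → Option (Fin r)) :
    ∃ (r' : ℕ) (b' : Fin m → Option (Fin r')),
      (∀ i, b' i = none ↔ b i = none) ∧ (∀ i k, b' i = b' k ↔ b i = b k) ∧ (∀ j', ∃ i, b' i = some j') := by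
  let U : Finset (Fin r) := univ.filter fun j => ∃ i, b i = some j
  let e := Fintype.equivFin {x // x ∈ U}
  let g : Fin r → Option (Fin (Fintype.card {x // x ∈ U})) := fun j => if h : j ∈ U then some (e ⟨j, h⟩) else none
  have hU : ∀ i j, b i = some j → j ∈ U := fun i j h => by
    simp only [U, mem_filter, mem_univ, true_and]; exact ⟨i, h⟩
  have hg : ∀ i j (h : b i = some j), g j = some (e ⟨j, hU i j h⟩) := fun i j h => dif_pos (hU i j h)
  refine ⟨Fintype.card {x // x ∈ U}, fun i => (b i).bind g, fun i => ?_, fun i k => ?_, fun j' => ?_⟩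
  · cases hbi : b i with
    | none => simp [hbi]
    | some j => simp [hbi, hg i j hbi]
  · cases hbi : b i with
    | none =>
      cases hbk : b k with
      | none => simp [hbi, hbk]
      | some l => simp [hbi, hbk, hg k l hbk]
    | some j =>
      cases hbk : b k with
      | none => simp [hbi, hbk, hg i j hbi]
      | some l => simp [hbi, hbk, hg i j hbi, hg k l hbk]
  · obtain ⟨⟨jj, hjj⟩, hx⟩ : ∃ x : {x // x ∈ U}, e x = j' := ⟨e.symm j', e.apply_symm_apply j'⟩
    have hjj' := hjj
    simp only [U, mem_filter, mem_univ, true_and] at hjj'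
    obtain ⟨i, hi⟩ := hjj'
    refine ⟨i, ?_⟩
    show (b i).bind g = some j'
    rw [hi]
    show g jj = some j'
    rw [hg i jj hi, ← hx]

/-- ★★★★ KERNEL — `TransferOfFieldCore` (NODE §2 (T), the node's junction): the field core PF gives the TRANSFER LEMMA.
With `closes_of_fieldCore` (§3): `FieldCorePerPrime → PartnersTwoOdd → StructureLawTwoOdd` is now kernel-checked END TO END;
the only non-kernel inputs left under piece B are PF itself (g22 «ProbeDial», paper ⟸ BFHHL13 + Assmus–Key) and the open
leaf `PartnersTwoOdd`. -/
theorem transferOfFieldCore_holds : TransferOfFieldCore := by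
  intro hPF p _ hp5 j
  obtain ⟨K, hK⟩ := hPF p hp5
  let ι : Type := Fin j ⊕ ((Fin j → Bool) × Fin K)
  refine ⟨Fintype.card ι, fun m r f b hf hfree hsw hbig => ?_⟩
  have hp3 : 3 ≤ p := by omega
  have h10 : (1 : ZMod p) ≠ 0 := one_ne_zero
  -- (a) re-index onto the used blocks
  obtain ⟨r', b', hnone, heq, hsurj⟩ := reindex b
  have hsw' : ∀ i k, b' i = b' k → b' i ≠ none → ∀ u : Fin m → Bool, f (u ∘ Equiv.swap i k) = f u := by
    intro i k hik hi u
    exact hsw i k ((heq i k).1 hik) (fun h => hi ((hnone i).2 h)) u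
  have hbig' : ∀ j', 3 * p - 1 ≤ (blockOf b' j').card := by
    intro j'
    obtain ⟨i, hi⟩ := hsurj j'
    have hbi : b i ≠ none := by
      intro h
      have h' := (hnone i).2 h
      rw [hi] at h'
      exact Option.some_ne_none _ h'
    have h1 := hbig i hbi
    have h2 : (univ.filter fun k => b k = b i) = blockOf b' j' := by
      ext k
      simp only [mem_filter, mem_univ, true_and, mem_blockOf]
      rw [← heq k i, hi]
    rw [h2] at h1
    exact h1
  -- (b) the free coordinates and the free patterns
  let Fr : Finset (Fin m) := univ.filter fun i => b i = none
  have memFr : ∀ i, i ∈ Fr ↔ b i = none := fun i => by simp [Fr]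
  let nF : ℕ := Fintype.card {x // x ∈ Fr}
  have hnF : nF ≤ j := by
    show Fintype.card {x // x ∈ Fr} ≤ j
    rw [Fintype.card_coe]; exact hfree
  let eF := Fintype.equivFin {x // x ∈ Fr}
  let zOf : (Fin j → Bool) → (Fin m → Bool) := fun ζ i =>
    if h : b i = none then ζ (Fin.castLE hnF (eF ⟨i, (memFr i).2 h⟩)) else false
  let ζOf : (Fin m → Bool) → (Fin j → Bool) := fun u q =>
    if h : (q : ℕ) < nF then u (eF.symm ⟨q, h⟩).1 else false
  have hzOf : ∀ (u : Fin m → Bool) (i : Fin m), b i = none → u i = zOf (ζOf u) i := by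
    intro u i hi
    simp only [zOf, dif_pos hi, ζOf]
    have hlt : ((Fin.castLE hnF (eF ⟨i, (memFr i).2 hi⟩)) : ℕ) < nF := by
      rw [Fin.val_castLE]; exact Fin.is_lt _
    rw [dif_pos hlt]
    have e1 : (⟨((Fin.castLE hnF (eF ⟨i, (memFr i).2 hi⟩)) : ℕ), hlt⟩ : Fin nF) = eF ⟨i, (memFr i).2 hi⟩ :=
      Fin.ext (by simp)
    rw [e1, Equiv.symm_apply_apply]
  -- (c) the field core on every free-pattern fibre
  have hcore := fun ζ : Fin j → Bool => field_core hp3 K hK hf b' hsw' hbig' (zOf ζ)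
  choose φ Fz hφF using hcore
  -- (d) the forms
  let c : (Fin j → Bool) → Fin K → Fin r' → ZMod p := fun ζ k j' => φ ζ k (fun l => if j' = l then 1 else 0)
  let lam' : ι → Fin m → ZMod p := Sum.elim
    (fun q i => if h : (q : ℕ) < nF then (if i = (eF.symm ⟨q, h⟩).1 then 1 else 0) else 0)
    (fun zk i => (b' i).elim 0 (c zk.1 zk.2))
  let dec : (ι → ZMod p) → (Fin j → Bool) := fun vals q => decide (vals (Sum.inl q) = 1)
  let F' : (ι → ZMod p) → Bool := fun vals => Fz (dec vals) (fun k => vals (Sum.inr (dec vals, k)))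
  let eqv := Fintype.equivFin ι
  refine ⟨fun q => lam' (eqv.symm q), fun vals => F' (fun x => vals (eqv x)), fun u => ?_⟩
  show f u = F' (fun x => ∑ i, if u i = true then lam' (eqv.symm (eqv x)) i else (0 : ZMod p))
  simp only [Equiv.symm_apply_apply]
  -- decode the free pattern from the first block of values
  have hdec : dec (fun x => ∑ i, if u i = true then lam' x i else 0) = ζOf u := by
    funext q
    simp only [dec, lam', Sum.elim_inl, ζOf]
    by_cases h : (q : ℕ) < nF
    · simp only [dif_pos h]
      have e1 : (∑ i : Fin m, if u i = true then (if i = (eF.symm ⟨q, h⟩).1 then (1 : ZMod p) else 0) else 0)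
          = if u (eF.symm ⟨q, h⟩).1 = true then 1 else 0 := by
        rw [Finset.sum_eq_single (eF.symm ⟨q, h⟩).1]
        · simp
        · intro i _ hi; simp [hi]
        · intro hh; exact absurd (mem_univ _) hh
      rw [e1]
      cases u (eF.symm ⟨q, h⟩).1 <;> simp [h10.symm]
    · simp only [dif_neg h]
      simp [h10.symm]
  have eF' : F' (fun x => ∑ i, if u i = true then lam' x i else 0)
      = Fz (ζOf u) (fun k => ∑ i, if u i = true then lam' (Sum.inr (ζOf u, k)) i else 0) := by
    simp only [F', hdec]
  rw [eF', hφF (ζOf u) u (fun i hi => hzOf u i ((hnone i).1 hi))]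
  congr 1
  funext k
  rw [LinearMap.pi_apply_eq_sum_univ (φ (ζOf u) k)]
  simp only [smul_eq_mul, lam', Sum.elim_inr]
  show ∑ j', (bw (blockOf b' j') u : ZMod p) * c (ζOf u) k j' = ∑ i, if u i = true then (b' i).elim 0 (c (ζOf u) k) else 0
  have hfib := Finset.sum_fiberwise_of_maps_to (s := (univ : Finset (Fin m))) (t := (univ : Finset (Option (Fin r'))))
    (g := b') (fun i _ => mem_univ _) (fun i => if u i = true then (b' i).elim 0 (c (ζOf u) k) else (0 : ZMod p))
  rw [← hfib, Fintype.sum_option]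
  have h0 : (∑ i ∈ univ.filter (fun i => b' i = none), if u i = true then (b' i).elim 0 (c (ζOf u) k) else (0 : ZMod p)) = 0 := by
    refine Finset.sum_eq_zero fun i hi => ?_
    rw [(mem_filter.1 hi).2]
    simp
  rw [h0, zero_add]
  refine Finset.sum_congr rfl fun j' _ => ?_
  rw [natCast_bw, Finset.sum_mul]
  refine Finset.sum_congr rfl fun i hi => ?_
  simp only [mem_filter, mem_univ, true_and] at hi
  rw [hi]
  cases u i <;> simp

end Assembly


/-- ★★★★ B from PF and PARTNERS, kernel end to end: `FieldCorePerPrime → PartnersTwoOdd → StructureLawTwoOdd`.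
(PF = g22 «ProbeDial», proved on paper from BFHHL13 [arXiv:1212.3849] + Assmus–Key Thm 5.7.9; `PartnersTwoOdd` = the open leaf.) -/
theorem closes_of_PF (hPF : FieldCorePerPrime) (hP : PartnersTwoOdd) : StructureLawTwoOdd :=
  closes_of_fieldCore transferOfFieldCore_holds hPF hP

end Summit.QuantumAdvantage.QuantumAdvantage.Theorems.TransferDial
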